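import Literature.AlgebraicGeometry.HodgeTheory.VHSDataSimultaneousDeterminationLocus
import Literature.AlgebraicGeometry.HodgeTheory.VHSDataSubHodgeStructureTranslateLocusExteriorPower
import HarnessLib

/-!
# Cattani–Deligne–Kaplan's Corollary 1.4 (`r = 1`) from bundled flat charts, for ONE rational subspace and for a FINITE COLLECTION of rational
# subspaces at once: the locus where one path class carries every `U_m ⊆ V_{s₀}` to a sub-Hodge structure is everything or finite

Topic `Literature/AlgebraicGeometry/HodgeTheory` (namespace `Literature.AlgebraicGeometry.Motives.VHSData[.IsLocallyFlatCharted]`), lane `lit-hodgefound`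
(seat `p08`, row g59-#13); sequel of `VHSDataSimultaneousDeterminationLocus` (Cor. 1.3 for finitely many classes at once) and of
`VHSDataSubHodgeStructureTranslateLocus[ExteriorPower]` (the Cor-1.4 locus of a line `ℚ·u₀` is the determination locus of `u₀`; of a `d`-dimensional
`U` that of an integral `m₁ ∧ ⋯ ∧ m_d` in `⋀ᵈ D`).  THEOREMS ONLY — no definition, no named fact, no instance (D-0026 net debt `0`).

PRINTED SOURCE, VERBATIM.  E. Cattani, P. Deligne, A. Kaplan, *On the locus of Hodge classes*, J. AMS 8 (1995) (held text `paper:arxiv-alg-geom_9402009`),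
p. 486: «**Corollary 1.4.** … fix `s ∈ S` and let `U_ℚ ⊂ (𝒱_s)_ℚ` be a rational subspace. The locus where some flat translate of `U_ℚ` is a Hodge
substructure is an algebraic subvariety of `S`. *Proof*: … suppose first that `U_ℚ` is of dimension one. … Let `e` be a generator of `U_ℚ ∩ 𝒱_ℤ`. Then
`U_ℚ` is a Hodge substructure if and only if `e` is of type `(0,0)`, and one applies 1.3. Consider now the general case: `U` of dimension `n`. … This
amounts to `⋀ⁿ U_ℝ ⊂ ⋀ⁿ H_ℝ` being stable under `ℂ*`, i.e., to `⋀ⁿ U_ℚ` being a Hodge substructure of `⋀ⁿ H_ℚ`, and reduces us to the one-dimensional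
case, proving 1.4.»  B. Moonen, F. Oort, arXiv:1112.0933 p. 9, §3 Def. 4 (finite collections: «`Y(t^{(1)}) ∩ ⋯ ∩ Y(t^{(r)})`. The image of this locus
in `S` …»).

* §1 **`IsLocallyFlatCharted.setOf_exists_forall_isHodgeAt_eq_univ_or_finite`** — Cor. 1.3 for finitely many classes `u m` of ONE locally
  flat-charted `D` (the constant family in `simultaneousDeterminationLocus_eq_univ_or_finite`).
* §2 ONE SUBSPACE, bundled: **`IsLocallyFlatCharted.translateLocus_line_eq_univ_or_finite`** (a line, charts of `D`),
  **`translateLocus_eq_univ_or_finite_of_isLocallyFlatCharted_exteriorPower`** (`dim U = d`, charts of `⋀ᵈ D`), `…_of_compactification`.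
* §3 A FINITE COLLECTION OF SUBSPACES `U_m ⊆ V_{s₀}` (`m ∈ ι'` finite), ONE path class for all:
  **`IsLocallyFlatCharted.setOf_exists_forall_subHodgeStructure_translate_line_eq_univ_or_finite`** (lines `ℚ·u_m`, charts of `D`),
  **`setOf_exists_forall_subHodgeStructure_translate_eq_univ_or_finite`** (`dim U_m = d_m`, charts of the `⋀^{d_m} D`), `…_of_compactification`.

HONEST SCOPE: `dim S = 1`; flat charts are hypotheses — of `D` for lines, of the exterior-power data `⋀^{d}D` (`VHSData.exteriorPower`) for
higher-dimensional subspaces, as in the printed reduction.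

## References

* [CattaniDeligneKaplan1995] E. Cattani, P. Deligne, A. Kaplan, *On the locus of Hodge classes*, J. Amer. Math. Soc. 8 (1995) 483–506: Cor. 1.3 (p. 484),
  Cor. 1.4 and its proof (p. 486), 2.3 (p. 487).
* [MoonenOort2013Torelli] B. Moonen, F. Oort, *The Torelli locus and special subvarieties*, Handbook of Moduli II (2013), §3 Def. 4, Rem. 5 (arXiv p. 9).
* [Schmid1973] W. Schmid, *Variation of Hodge structure: the singularities of the period mapping*, Invent. Math. 22 (1973), §2 (cite only).
-/

noncomputable section

open scoped TensorProduct
open _root_.Topology _root_.Filter Set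

universe u

namespace Literature.AlgebraicGeometry

open Motives Motives.HodgeStructure HodgeTheory Topology

namespace Motives.VHSData

variable {S : Type} [TopologicalSpace S] {k : ℤ} {D : VHSData S k} {ι' : Type*}
variable {α ι : Type*} {ψ : α → OpenPartialHomeomorph S ℂ} {σ : ι → ℂ → S}
variable {X : Type*} [TopologicalSpace X] [CompactSpace X]

/-! ## §1 Corollary 1.3 for finitely many classes of ONE locally flat-charted variation -/

namespace IsLocallyFlatCharted

/-- **COR. 1.3 FOR FINITELY MANY INTEGRAL CLASSES `u m ∈ V_ℤ,s₀` OF ONE LOCALLY FLAT-CHARTED `D`**: `S` preconnected, covered by the discs, open ends,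
compact core, continuous ends; `p m + p m = k`.  **The set of `t ∈ S` for which ONE path class carries EVERY `u m` to a class of type `(p m, p m)` is
ALL of `S` or FINITE** (the image in `S` of `Y(u_1) ∩ ⋯ ∩ Y(u_r)`). [cite: CattaniDeligneKaplan1995, Cor. 1.3 (p. 484)]
[cite: MoonenOort2013Torelli, §3 Def. 4 and Rem. 5 (arXiv p. 9)] -/
theorem setOf_exists_forall_isHodgeAt_eq_univ_or_finite [PreconnectedSpace S] [Finite ι'] (h : D.IsLocallyFlatCharted ψ σ) {p : ι' → ℤ}
    (hpk : ∀ m, p m + p m = k) {s₀ : S} (u : ι' → D.VZ.fiber s₀) (hcov : ∀ x : S, ∃ a, x ∈ (ψ a).source) (A : ι → ℝ)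
    (hopen : ∀ (i : ι) (A' : ℝ), A i ≤ A' → IsOpen (σ i '' {z : ℂ | A' < z.im}))
    (hcore : ∀ A' : ι → ℝ, (∀ i, A i ≤ A' i) → ∃ K₀ : Set S, IsCompact K₀ ∧ K₀ ∪ ⋃ i, σ i '' {z : ℂ | A' i < z.im} = univ)
    (hcont : ∀ i, ContinuousOn (σ i) {z : ℂ | A i < z.im}) :
    {t : S | ∃ γ : Path.Homotopic.Quotient s₀ t, ∀ m, D.IsHodgeAt t (p m) (D.VZ.transport γ (u m))} = univ ∨
      {t : S | ∃ γ : Path.Homotopic.Quotient s₀ t, ∀ m, D.IsHodgeAt t (p m) (D.VZ.transport γ (u m))}.Finite :=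
  simultaneousDeterminationLocus_eq_univ_or_finite (D := fun _ : ι' => D) (fun _ => h) hpk u hcov A hopen hcore hcont

/-- **The same over a PUNCTURED COMPACT CURVE.** [cite: CattaniDeligneKaplan1995, Cor. 1.3 (p. 484), 2.3 (p. 487)] -/
theorem setOf_exists_forall_isHodgeAt_eq_univ_or_finite_of_compactification [PreconnectedSpace S] [Finite ι'] (h : D.IsLocallyFlatCharted ψ σ)
    {p : ι' → ℤ} (hpk : ∀ m, p m + p m = k) {s₀ : S} (u : ι' → D.VZ.fiber s₀) (hcov : ∀ x : S, ∃ a, x ∈ (ψ a).source) (A : ι → ℝ)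
    {j : S → X} (hj : IsEmbedding j) (pt : ι → X) (hpS : ∀ i, pt i ∉ range j) (hcovX : ∀ x : X, x ∉ range j → ∃ i, x = pt i)
    (φ : ι → OpenPartialHomeomorph X ℂ) (hp : ∀ i, pt i ∈ (φ i).source) (hφp : ∀ i, φ i (pt i) = 0)
    (hball : ∀ i, Metric.ball (0 : ℂ) (Real.exp (-(2 * Real.pi * A i))) ⊆ (φ i).target)
    (hσ : ∀ (i : ι) (z : ℂ), A i < z.im → j (σ i z) = (φ i).symm (Complex.exp (2 * Real.pi * Complex.I * z))) :
    {t : S | ∃ γ : Path.Homotopic.Quotient s₀ t, ∀ m, D.IsHodgeAt t (p m) (D.VZ.transport γ (u m))} = univ ∨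
      {t : S | ∃ γ : Path.Homotopic.Quotient s₀ t, ∀ m, D.IsHodgeAt t (p m) (D.VZ.transport γ (u m))}.Finite :=
  simultaneousDeterminationLocus_eq_univ_or_finite_of_compactification (D := fun _ : ι' => D) (fun _ => h) hpk u hcov A hj pt hpS hcovX φ
    hp hφp hball hσ

/-! ## §2 Corollary 1.4 for ONE rational subspace, from bundled flat charts -/

/-- **COR. 1.4 FOR A RATIONAL LINE `ℚ·u₀` FROM FLAT CHARTS OF `D`** («`U_ℚ` is a Hodge substructure if and only if `e` is of type `(0,0)`, and one
applies 1.3»): for `u₀ ≠ 0` integral and `p + p = k`, **the set of `t` such that SOME flat translate `γ · (ℚ·u₀) ⊆ V_t` underlies a sub-Hodge structure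
is ALL of `S` or FINITE.** [cite: CattaniDeligneKaplan1995, Cor. 1.4 and its proof (p. 486), Cor. 1.3 (p. 484)] -/
theorem translateLocus_line_eq_univ_or_finite [PreconnectedSpace S] (h : D.IsLocallyFlatCharted ψ σ) {p : ℤ} (hpk : p + p = k) {s₀ : S}
    {u₀ : D.VZ.fiber s₀} (hu₀ : u₀ ≠ 0) (hcov : ∀ x : S, ∃ a, x ∈ (ψ a).source) (A : ι → ℝ)
    (hopen : ∀ (i : ι) (A' : ℝ), A i ≤ A' → IsOpen (σ i '' {z : ℂ | A' < z.im}))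
    (hcore : ∀ A' : ι → ℝ, (∀ i, A i ≤ A' i) → ∃ K₀ : Set S, IsCompact K₀ ∧ K₀ ∪ ⋃ i, σ i '' {z : ℂ | A' i < z.im} = univ)
    (hcont : ∀ i, ContinuousOn (σ i) {z : ℂ | A i < z.im}) :
    {t : S | ∃ γ : Path.Homotopic.Quotient s₀ t, ∃ W : SubHodgeStructure (D.hodge t),
        W.toSubmodule = (ℚ ∙ D.toRat s₀ u₀).map (D.V.transport γ)} = univ ∨
      {t : S | ∃ γ : Path.Homotopic.Quotient s₀ t, ∃ W : SubHodgeStructure (D.hodge t),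
        W.toSubmodule = (ℚ ∙ D.toRat s₀ u₀).map (D.V.transport γ)}.Finite := by
  haveI : ∀ s : S, Module.Finite ℚ (D.V.fiber s) := fun s => D.finite_fiber s
  rw [D.translateLocus_line_eq_determinationLocus s₀ hu₀ hpk]
  exact h.determinationLocus_eq_univ_or_finite hpk u₀ hcov A hopen hcore hcont

end IsLocallyFlatCharted

/-- **COR. 1.4 FOR A RATIONAL SUBSPACE `U ⊆ V_{s₀}` OF DIMENSION `d`, FROM FLAT CHARTS OF `⋀ᵈ D`** («reduces us to the one-dimensional case»: the locus
of `U` is the determination locus of an integral `m₁ ∧ ⋯ ∧ m_d` in `⋀ᵈ D`, `P + P = d·k`): **everything or finite.**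
[cite: CattaniDeligneKaplan1995, Cor. 1.4 and its proof (p. 486), Cor. 1.3 (p. 484)] -/
theorem translateLocus_eq_univ_or_finite_of_isLocallyFlatCharted_exteriorPower [PreconnectedSpace S] {d : ℕ}
    (h : (D.exteriorPower d).IsLocallyFlatCharted ψ σ) {P : ℤ} (hP : P + P = d * k) {s₀ : S} (U : Submodule ℚ (D.V.fiber s₀))
    (hd : Module.finrank ℚ U = d) (hcov : ∀ x : S, ∃ a, x ∈ (ψ a).source) (A : ι → ℝ)
    (hopen : ∀ (i : ι) (A' : ℝ), A i ≤ A' → IsOpen (σ i '' {z : ℂ | A' < z.im}))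
    (hcore : ∀ A' : ι → ℝ, (∀ i, A i ≤ A' i) → ∃ K₀ : Set S, IsCompact K₀ ∧ K₀ ∪ ⋃ i, σ i '' {z : ℂ | A' i < z.im} = univ)
    (hcont : ∀ i, ContinuousOn (σ i) {z : ℂ | A i < z.im}) :
    {t : S | ∃ γ : Path.Homotopic.Quotient s₀ t, ∃ W : SubHodgeStructure (D.hodge t), W.toSubmodule = U.map (D.V.transport γ)} = univ ∨
      {t : S | ∃ γ : Path.Homotopic.Quotient s₀ t, ∃ W : SubHodgeStructure (D.hodge t), W.toSubmodule = U.map (D.V.transport γ)}.Finite := by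
  obtain ⟨m, -, heq⟩ := D.exists_translateLocus_eq_determinationLocus_exteriorPower s₀ U hd hP
  rw [heq]
  exact h.determinationLocus_eq_univ_or_finite hP _ hcov A hopen hcore hcont

/-- **The same over a PUNCTURED COMPACT CURVE.** [cite: CattaniDeligneKaplan1995, Cor. 1.4 (p. 486), 2.3 (p. 487)] -/
theorem translateLocus_eq_univ_or_finite_of_isLocallyFlatCharted_exteriorPower_of_compactification [PreconnectedSpace S] {d : ℕ}
    (h : (D.exteriorPower d).IsLocallyFlatCharted ψ σ) {P : ℤ} (hP : P + P = d * k) {s₀ : S} (U : Submodule ℚ (D.V.fiber s₀))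
    (hd : Module.finrank ℚ U = d) (hcov : ∀ x : S, ∃ a, x ∈ (ψ a).source) (A : ι → ℝ)
    {j : S → X} (hj : IsEmbedding j) (pt : ι → X) (hpS : ∀ i, pt i ∉ range j) (hcovX : ∀ x : X, x ∉ range j → ∃ i, x = pt i)
    (φ : ι → OpenPartialHomeomorph X ℂ) (hp : ∀ i, pt i ∈ (φ i).source) (hφp : ∀ i, φ i (pt i) = 0)
    (hball : ∀ i, Metric.ball (0 : ℂ) (Real.exp (-(2 * Real.pi * A i))) ⊆ (φ i).target)
    (hσ : ∀ (i : ι) (z : ℂ), A i < z.im → j (σ i z) = (φ i).symm (Complex.exp (2 * Real.pi * Complex.I * z))) :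
    {t : S | ∃ γ : Path.Homotopic.Quotient s₀ t, ∃ W : SubHodgeStructure (D.hodge t), W.toSubmodule = U.map (D.V.transport γ)} = univ ∨
      {t : S | ∃ γ : Path.Homotopic.Quotient s₀ t, ∃ W : SubHodgeStructure (D.hodge t), W.toSubmodule = U.map (D.V.transport γ)}.Finite :=
  translateLocus_eq_univ_or_finite_of_isLocallyFlatCharted_exteriorPower h hP U hd hcov A (Topology.isOpen_image_ends hj φ A hball σ hσ)
    (Topology.exists_isCompact_core hj pt hpS hcovX φ hp hφp A hball σ hσ) (continuousOn_end_lifts hj φ A hball σ hσ)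

/-! ## §3 Corollary 1.4 for a FINITE COLLECTION of rational subspaces, one path class for all -/

namespace IsLocallyFlatCharted

/-- **COR. 1.4 FOR FINITELY MANY RATIONAL LINES `ℚ·u_m ⊆ V_{s₀}` AT ONCE, FROM FLAT CHARTS OF `D`**: for `u m ≠ 0` integral (`m ∈ ι'` finite) and
`p + p = k`, **the set of `t ∈ S` for which ONE path class `γ : s₀ ⇝ t` carries EVERY line `ℚ·u_m` to a sub-Hodge structure of `V_t` is ALL of `S` or
FINITE** (each line is a sub-Hodge structure iff its generator is of type `(p,p)`: the simultaneous determination locus of the `u m`).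
[cite: CattaniDeligneKaplan1995, Cor. 1.4 and its proof (p. 486), Cor. 1.3 (p. 484)] [cite: MoonenOort2013Torelli, §3 Def. 4 (arXiv p. 9)] -/
theorem setOf_exists_forall_subHodgeStructure_translate_line_eq_univ_or_finite [PreconnectedSpace S] [Finite ι']
    (h : D.IsLocallyFlatCharted ψ σ) {p : ℤ} (hpk : p + p = k) {s₀ : S} {u : ι' → D.VZ.fiber s₀} (hu : ∀ m, u m ≠ 0)
    (hcov : ∀ x : S, ∃ a, x ∈ (ψ a).source) (A : ι → ℝ) (hopen : ∀ (i : ι) (A' : ℝ), A i ≤ A' → IsOpen (σ i '' {z : ℂ | A' < z.im}))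
    (hcore : ∀ A' : ι → ℝ, (∀ i, A i ≤ A' i) → ∃ K₀ : Set S, IsCompact K₀ ∧ K₀ ∪ ⋃ i, σ i '' {z : ℂ | A' i < z.im} = univ)
    (hcont : ∀ i, ContinuousOn (σ i) {z : ℂ | A i < z.im}) :
    {t : S | ∃ γ : Path.Homotopic.Quotient s₀ t, ∀ m, ∃ W : SubHodgeStructure (D.hodge t),
        W.toSubmodule = (ℚ ∙ D.toRat s₀ (u m)).map (D.V.transport γ)} = univ ∨
      {t : S | ∃ γ : Path.Homotopic.Quotient s₀ t, ∀ m, ∃ W : SubHodgeStructure (D.hodge t),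
        W.toSubmodule = (ℚ ∙ D.toRat s₀ (u m)).map (D.V.transport γ)}.Finite := by
  haveI : ∀ s : S, Module.Finite ℚ (D.V.fiber s) := fun s => D.finite_fiber s
  have heq : {t : S | ∃ γ : Path.Homotopic.Quotient s₀ t, ∀ m, ∃ W : SubHodgeStructure (D.hodge t),
      W.toSubmodule = (ℚ ∙ D.toRat s₀ (u m)).map (D.V.transport γ)} =
      {t : S | ∃ γ : Path.Homotopic.Quotient s₀ t, ∀ m, D.IsHodgeAt t p (D.VZ.transport γ (u m))} :=
    Set.ext fun _ => exists_congr fun γ => forall_congr' fun m => D.exists_subHodgeStructure_translate_line_iff_isHodgeAt γ (hu m) hpk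
  rw [heq]
  exact h.setOf_exists_forall_isHodgeAt_eq_univ_or_finite (fun _ => hpk) u hcov A hopen hcore hcont

end IsLocallyFlatCharted

/-- **COR. 1.4 FOR FINITELY MANY RATIONAL SUBSPACES `U_m ⊆ V_{s₀}` OF DIMENSIONS `d_m` AT ONCE, FROM FLAT CHARTS OF THE `⋀^{d_m} D`**: with
`P m + P m = d_m·k`, **the set of `t ∈ S` for which ONE path class `γ : s₀ ⇝ t` carries EVERY `U_m` to a sub-Hodge structure of `V_t` is ALL of `S`
or FINITE** — each `U_m` has an integral frame `m₁ ∧ ⋯ ∧ m_{d_m}` whose determination locus in `⋀^{d_m} D` is the locus of `U_m` (pointwise in `γ`),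
so the set is the simultaneous determination locus of the frames in the family `(⋀^{d_m} D)_m`.
[cite: CattaniDeligneKaplan1995, Cor. 1.4 and its proof (p. 486), Cor. 1.3 (p. 484)] [cite: MoonenOort2013Torelli, §3 Def. 4 (arXiv p. 9)] -/
theorem setOf_exists_forall_subHodgeStructure_translate_eq_univ_or_finite [PreconnectedSpace S] [Finite ι'] {d : ι' → ℕ}
    (h : ∀ m, (D.exteriorPower (d m)).IsLocallyFlatCharted ψ σ) {P : ι' → ℤ} (hP : ∀ m, P m + P m = d m * k) {s₀ : S}
    (U : ι' → Submodule ℚ (D.V.fiber s₀)) (hd : ∀ m, Module.finrank ℚ (U m) = d m) (hcov : ∀ x : S, ∃ a, x ∈ (ψ a).source) (A : ι → ℝ)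
    (hopen : ∀ (i : ι) (A' : ℝ), A i ≤ A' → IsOpen (σ i '' {z : ℂ | A' < z.im}))
    (hcore : ∀ A' : ι → ℝ, (∀ i, A i ≤ A' i) → ∃ K₀ : Set S, IsCompact K₀ ∧ K₀ ∪ ⋃ i, σ i '' {z : ℂ | A' i < z.im} = univ)
    (hcont : ∀ i, ContinuousOn (σ i) {z : ℂ | A i < z.im}) :
    {t : S | ∃ γ : Path.Homotopic.Quotient s₀ t, ∀ m, ∃ W : SubHodgeStructure (D.hodge t), W.toSubmodule = (U m).map (D.V.transport γ)} =
        univ ∨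
      {t : S | ∃ γ : Path.Homotopic.Quotient s₀ t, ∀ m, ∃ W : SubHodgeStructure (D.hodge t),
        W.toSubmodule = (U m).map (D.V.transport γ)}.Finite := by
  have hfr := fun m => D.exists_integral_frame s₀ (hd m)
  choose fr hli hU using hfr
  have heq : {t : S | ∃ γ : Path.Homotopic.Quotient s₀ t, ∀ m, ∃ W : SubHodgeStructure (D.hodge t),
      W.toSubmodule = (U m).map (D.V.transport γ)} =
      {t : S | ∃ γ : Path.Homotopic.Quotient s₀ t, ∀ m, (D.exteriorPower (d m)).IsHodgeAt t (P m)
        ((D.exteriorPower (d m)).VZ.transport γ (_root_.exteriorPower.ιMulti ℤ (d m) (fr m)))} :=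
    Set.ext fun _ => exists_congr fun γ => forall_congr' fun m =>
      D.exists_subHodgeStructure_translate_iff_isHodgeAt_exteriorPower_of_finrank_eq γ (hli m) (hU m) (hd m) (hP m)
  rw [heq]
  exact simultaneousDeterminationLocus_eq_univ_or_finite (D := fun m => D.exteriorPower (d m)) h hP _ hcov A hopen hcore hcont

/-- **The same over a PUNCTURED COMPACT CURVE.** [cite: CattaniDeligneKaplan1995, Cor. 1.4 (p. 486), 2.3 (p. 487)]
[cite: MoonenOort2013Torelli, §3 Def. 4 (arXiv p. 9)] -/
theorem setOf_exists_forall_subHodgeStructure_translate_eq_univ_or_finite_of_compactification [PreconnectedSpace S] [Finite ι'] {d : ι' → ℕ}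
    (h : ∀ m, (D.exteriorPower (d m)).IsLocallyFlatCharted ψ σ) {P : ι' → ℤ} (hP : ∀ m, P m + P m = d m * k) {s₀ : S}
    (U : ι' → Submodule ℚ (D.V.fiber s₀)) (hd : ∀ m, Module.finrank ℚ (U m) = d m) (hcov : ∀ x : S, ∃ a, x ∈ (ψ a).source) (A : ι → ℝ)
    {j : S → X} (hj : IsEmbedding j) (pt : ι → X) (hpS : ∀ i, pt i ∉ range j) (hcovX : ∀ x : X, x ∉ range j → ∃ i, x = pt i)
    (φ : ι → OpenPartialHomeomorph X ℂ) (hp : ∀ i, pt i ∈ (φ i).source) (hφp : ∀ i, φ i (pt i) = 0)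
    (hball : ∀ i, Metric.ball (0 : ℂ) (Real.exp (-(2 * Real.pi * A i))) ⊆ (φ i).target)
    (hσ : ∀ (i : ι) (z : ℂ), A i < z.im → j (σ i z) = (φ i).symm (Complex.exp (2 * Real.pi * Complex.I * z))) :
    {t : S | ∃ γ : Path.Homotopic.Quotient s₀ t, ∀ m, ∃ W : SubHodgeStructure (D.hodge t), W.toSubmodule = (U m).map (D.V.transport γ)} =
        univ ∨
      {t : S | ∃ γ : Path.Homotopic.Quotient s₀ t, ∀ m, ∃ W : SubHodgeStructure (D.hodge t),
        W.toSubmodule = (U m).map (D.V.transport γ)}.Finite :=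
  setOf_exists_forall_subHodgeStructure_translate_eq_univ_or_finite h hP U hd hcov A (Topology.isOpen_image_ends hj φ A hball σ hσ)
    (Topology.exists_isCompact_core hj pt hpS hcovX φ hp hφp A hball σ hσ) (continuousOn_end_lifts hj φ A hball σ hσ)

end Motives.VHSData

end Literature.AlgebraicGeometry

end
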